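import Summits.CriticalPhenomena.PercolationContinuityZ3.Theorems.PercNearOneGluingNoHeavyQuantMonoHubPairing
import HarnessLib

/-!
# QUANT lane R8, FAR on trees: the profile conjecture for MONOTONE hub laws, III — TWO jointly-light root blocks of
# arbitrary (different) gates

builds on p205010 (kernel theorem, internal audit signed; external expert review pending)

Support file (`--supports stmt-CriticalPhenomena-4575`), QUANT lane typer seat prim-quant-stmt (gen 13); memo
`run/shared/lean/prim/quant/prim-quant-stmt-g13/MONO-RELAXATION.md` §4; Part I is `…QuantMonoHubPairing.lean` (`Quant.reflect_pairing`).
Theorems only; no definitions, no sorries, standard axioms.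

Two root blocks `(a₁, g₁)`, `(a₂, g₂)` with `a₁ ≤ a₂` and `a₁ + a₂ ≤ j` ("jointly light"; `k₀ := j − a₁ − a₂`).  The block profile has five zones:
`ℓ_b = 0` (`b ≤ k₀`), `g₁g₂` (`k₀ < b ≤ j−a₂`), `g₂` (`j−a₂ < b ≤ j−a₁`), `π = g₁+g₂−g₁g₂` (`j−a₁ < b ≤ j`), `1` (`b > j`).

* `Quant.mono_profile_twoLightBlocks` — pure form: for `p ≥ 0` nondecreasing on `[1, j+k₀]`, `j+k₀+1 ≤ m ≤ M`, and `M·g₂ ≥ j − a₁`,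
  `M·(g₁+g₂) ≥ 2j − a₂`, `M·π ≥ j`:  `Σ_{b≤m} b·p b ≤ M·Σ_{b≤m} p b·ℓ_b`.  Proof: the zero zone is paid by the levels `(j, j+k₀]` through the
  reflection pairing; the `g₁g₂`-zone deficit is SHIFTED by `a₂` onto the `π`-zone (`p_b ≤ p_{b+a₂}`, pair sum `M(g₁+g₂) − 2b − a₂ ≥ 0`); the
  `g₂`-zone and the top are nonnegative termwise.
* `Quant.pair_blockSum_eq`, `Quant.pair_blockSum_real` — the block-sum events of `K = {x, y}` on the five ranges of the level.
* `Quant.hubBlocksProfileIneq_mono_pair` — **the profile conjecture `Quant.HubBlocksProfileIneq` for `K = {x, y}` with `size x + size y ≤ j`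
  (any two gates), for every hub law monotone below the mean**, in the conjecture's binder shape (given `size x ≤ size y`; the symmetric case is
  the same statement after swapping `x, y`).  First kernel instance of FAR's 'loose hub + root blocks' family with two root blocks of DIFFERENT
  intermediate gates and the true mean.  [cite: KozmaNitzan2024, Conjecture 3 (p. 15)] (the gluing rows served); the inequalities are [this work].
-/

noncomputable section

namespace Summit.CriticalPhenomena.PercolationContinuityZ3.Theorems

namespace Quant

open Finset MeasureTheory
open Literature.Probability.LatticeModels
open Literature.Probability.Percolation
open scoped Classical

/-! ### 1. Pure form -/

set_option maxHeartbeats 400000 in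
/-- **The profile inequality for two jointly-light blocks, monotone hub law, pure form** (see the module doc for the five zones and the two
pairings). [this work] -/
theorem mono_profile_twoLightBlocks (p : ℕ → ℝ) (m j a₁ a₂ : ℕ) (M g₁ g₂ : ℝ) (h12 : a₁ ≤ a₂) (hj : a₁ + a₂ ≤ j)
    (hp0 : ∀ b, 0 ≤ p b) (hmono : ∀ b b' : ℕ, 1 ≤ b → b ≤ b' → b' ≤ 2 * j - a₁ - a₂ → p b ≤ p b')
    (hm : 2 * j - a₁ - a₂ + 1 ≤ m) (hM : (m : ℝ) ≤ M)
    (hC1 : (j : ℝ) - a₁ ≤ M * g₂) (hC2 : (2 * j : ℝ) - a₂ ≤ M * (g₁ + g₂)) (hC3 : (j : ℝ) ≤ M * (g₁ + g₂ - g₁ * g₂)) :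
    ∑ b ∈ Finset.range (m + 1), (b : ℝ) * p b ≤
      M * ∑ b ∈ Finset.range (m + 1), p b *
        ((if j < b then (1 : ℝ) else 0) + (g₁ + g₂ - g₁ * g₂) * (if j - a₁ < b ∧ b ≤ j then (1 : ℝ) else 0) +
          g₂ * (if j - a₂ < b ∧ b ≤ j - a₁ then (1 : ℝ) else 0) + g₁ * g₂ * (if j - a₁ - a₂ < b ∧ b ≤ j - a₂ then (1 : ℝ) else 0)) := by
  set k₀ : ℕ := j - a₁ - a₂ with hk₀
  set π : ℝ := g₁ + g₂ - g₁ * g₂ with hπ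
  have hk₀j : k₀ ≤ j := by omega
  have hjk : j + k₀ = 2 * j - a₁ - a₂ := by omega
  -- termwise inequality with four correction terms
  have key : ∀ b ∈ Finset.range (m + 1), (b : ℝ) * p b ≤
      M * (p b * ((if j < b then (1 : ℝ) else 0) + π * (if j - a₁ < b ∧ b ≤ j then (1 : ℝ) else 0) +
          g₂ * (if j - a₂ < b ∧ b ≤ j - a₁ then (1 : ℝ) else 0) + g₁ * g₂ * (if j - a₁ - a₂ < b ∧ b ≤ j - a₂ then (1 : ℝ) else 0))) +
        (if b ≤ k₀ then (b : ℝ) * p b else 0) - (if j < b ∧ b ≤ j + k₀ then (M - b) * p b else 0) +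
        (if k₀ < b ∧ b ≤ j - a₂ then (M * π - (b + a₂ : ℕ)) * p (b + a₂) else 0) -
        (if j - a₁ < b ∧ b ≤ j then (M * π - b) * p b else 0) := by
    intro b hb
    have hbm : b ≤ m := by have := Finset.mem_range.1 hb; omega
    have hbM : (b : ℝ) ≤ M := (show (b : ℝ) ≤ m by exact_mod_cast hbm).trans hM
    have hpb := hp0 b
    by_cases hz : b ≤ k₀
    · -- zero zone
      have c1 : ¬ j < b := by omega
      have c2 : ¬ (j - a₁ < b ∧ b ≤ j) := by omega
      have c3 : ¬ (j - a₂ < b ∧ b ≤ j - a₁) := by omega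
      have c4 : ¬ (j - a₁ - a₂ < b ∧ b ≤ j - a₂) := by omega
      have c5 : ¬ (j < b ∧ b ≤ j + k₀) := by omega
      have c6 : ¬ (k₀ < b ∧ b ≤ j - a₂) := by omega
      rw [if_neg c1, if_neg c2, if_neg c3, if_neg c4, if_pos hz, if_neg c5, if_neg c6, if_neg c2]
      have e : M * (p b * ((0 : ℝ) + π * 0 + g₂ * 0 + g₁ * g₂ * 0)) = 0 := by ring
      linarith
    by_cases hgg : b ≤ j - a₂
    · -- g₁g₂ zone: shift the deficit by a₂
      have c1 : ¬ j < b := by omega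
      have c2 : ¬ (j - a₁ < b ∧ b ≤ j) := by omega
      have c3 : ¬ (j - a₂ < b ∧ b ≤ j - a₁) := by omega
      have c4 : (j - a₁ - a₂ < b ∧ b ≤ j - a₂) := by omega
      have c5 : ¬ (j < b ∧ b ≤ j + k₀) := by omega
      have c6 : (k₀ < b ∧ b ≤ j - a₂) := by omega
      rw [if_neg c1, if_neg c2, if_neg c3, if_pos c4, if_neg hz, if_neg c5, if_pos c6, if_neg c2]
      have hpp : p b ≤ p (b + a₂) := hmono b (b + a₂) (by omega) (by omega) (by omega)
      have hcast : ((b + a₂ : ℕ) : ℝ) = (b : ℝ) + a₂ := by push_cast; ring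
      have hb2 : (2 * b : ℝ) + a₂ ≤ 2 * j - a₂ := by
        have : 2 * b + a₂ + a₂ ≤ 2 * j := by omega
        have : ((2 * b + a₂ + a₂ : ℕ) : ℝ) ≤ ((2 * j : ℕ) : ℝ) := by exact_mod_cast this
        push_cast at this; linarith
      have hpair : (b : ℝ) - M * (g₁ * g₂) ≤ M * π - ((b : ℝ) + a₂) := by rw [hπ]; nlinarith
      have hnn : 0 ≤ M * π - ((b : ℝ) + a₂) := by
        have : (b : ℝ) + a₂ ≤ j := by
          have : b + a₂ ≤ j := by omega
          exact_mod_cast this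
        linarith
      rw [hcast]
      have e : M * (p b * ((0 : ℝ) + π * 0 + g₂ * 0 + g₁ * g₂ * 1)) = M * (g₁ * g₂) * p b := by ring
      rw [e]
      -- `b p b = M g₁g₂ p b + (b − M g₁g₂) p b ≤ M g₁g₂ p b + (Mπ − b − a₂) p (b+a₂)`
      by_cases hs : (b : ℝ) ≤ M * (g₁ * g₂)
      · have e1 : (b : ℝ) * p b ≤ M * (g₁ * g₂) * p b := mul_le_mul_of_nonneg_right hs hpb
        have e2 : 0 ≤ (M * π - ((b : ℝ) + a₂)) * p (b + a₂) := mul_nonneg hnn (hp0 _)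
        linarith
      · push Not at hs
        have e1 : ((b : ℝ) - M * (g₁ * g₂)) * p b ≤ ((b : ℝ) - M * (g₁ * g₂)) * p (b + a₂) :=
          mul_le_mul_of_nonneg_left hpp (by linarith)
        have e2 : ((b : ℝ) - M * (g₁ * g₂)) * p (b + a₂) ≤ (M * π - ((b : ℝ) + a₂)) * p (b + a₂) :=
          mul_le_mul_of_nonneg_right hpair (hp0 _)
        nlinarith
    by_cases hg2 : b ≤ j - a₁
    · -- g₂ zone: nonnegative
      have c1 : ¬ j < b := by omega
      have c2 : ¬ (j - a₁ < b ∧ b ≤ j) := by omega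
      have c3 : (j - a₂ < b ∧ b ≤ j - a₁) := by omega
      have c4 : ¬ (j - a₁ - a₂ < b ∧ b ≤ j - a₂) := by omega
      have c5 : ¬ (j < b ∧ b ≤ j + k₀) := by omega
      have c6 : ¬ (k₀ < b ∧ b ≤ j - a₂) := by omega
      rw [if_neg c1, if_neg c2, if_pos c3, if_neg c4, if_neg hz, if_neg c5, if_neg c6, if_neg c2]
      have hbj : (b : ℝ) ≤ j - a₁ := by
        have : b + a₁ ≤ j := by omega
        have : ((b + a₁ : ℕ) : ℝ) ≤ j := by exact_mod_cast this
        push_cast at this; linarith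
      have e1 : (b : ℝ) * p b ≤ (M * g₂) * p b := mul_le_mul_of_nonneg_right (hbj.trans hC1) hpb
      have e : M * (p b * ((0 : ℝ) + π * 0 + g₂ * 1 + g₁ * g₂ * 0)) = (M * g₂) * p b := by ring
      linarith
    by_cases hpi : b ≤ j
    · -- π zone: target of the shift (exact)
      have c1 : ¬ j < b := by omega
      have c2 : (j - a₁ < b ∧ b ≤ j) := by omega
      have c3 : ¬ (j - a₂ < b ∧ b ≤ j - a₁) := by omega
      have c4 : ¬ (j - a₁ - a₂ < b ∧ b ≤ j - a₂) := by omega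
      have c5 : ¬ (j < b ∧ b ≤ j + k₀) := by omega
      have c6 : ¬ (k₀ < b ∧ b ≤ j - a₂) := by omega
      rw [if_neg c1, if_pos c2, if_neg c3, if_neg c4, if_neg hz, if_neg c5, if_neg c6, if_pos c2]
      have e : M * (p b * ((0 : ℝ) + π * 1 + g₂ * 0 + g₁ * g₂ * 0)) = M * π * p b := by ring
      linarith
    by_cases hr : b ≤ j + k₀
    · -- reflection targets (exact)
      have c1 : j < b := by omega
      have c2 : ¬ (j - a₁ < b ∧ b ≤ j) := by omega
      have c3 : ¬ (j - a₂ < b ∧ b ≤ j - a₁) := by omega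
      have c4 : ¬ (j - a₁ - a₂ < b ∧ b ≤ j - a₂) := by omega
      have c5 : (j < b ∧ b ≤ j + k₀) := by omega
      have c6 : ¬ (k₀ < b ∧ b ≤ j - a₂) := by omega
      rw [if_pos c1, if_neg c2, if_neg c3, if_neg c4, if_neg hz, if_pos c5, if_neg c6, if_neg c2]
      have e : M * (p b * ((1 : ℝ) + π * 0 + g₂ * 0 + g₁ * g₂ * 0)) = M * p b := by ring
      linarith
    · -- top: nonnegative
      have c1 : j < b := by omega
      have c2 : ¬ (j - a₁ < b ∧ b ≤ j) := by omega
      have c3 : ¬ (j - a₂ < b ∧ b ≤ j - a₁) := by omega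
      have c4 : ¬ (j - a₁ - a₂ < b ∧ b ≤ j - a₂) := by omega
      have c5 : ¬ (j < b ∧ b ≤ j + k₀) := by omega
      have c6 : ¬ (k₀ < b ∧ b ≤ j - a₂) := by omega
      rw [if_pos c1, if_neg c2, if_neg c3, if_neg c4, if_neg hz, if_neg c5, if_neg c6, if_neg c2]
      have e3 : (b : ℝ) * p b ≤ M * p b := mul_le_mul_of_nonneg_right hbM hpb
      have e : M * (p b * ((1 : ℝ) + π * 0 + g₂ * 0 + g₁ * g₂ * 0)) = M * p b := by ring
      linarith
  have hS := Finset.sum_le_sum key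
  rw [Finset.sum_sub_distrib, Finset.sum_add_distrib, Finset.sum_sub_distrib, Finset.sum_add_distrib, ← Finset.mul_sum] at hS
  -- identify the four correction sums
  have e1 : ∑ b ∈ Finset.range (m + 1), (if b ≤ k₀ then (b : ℝ) * p b else 0) =
      ∑ b ∈ Finset.range (k₀ + 1), (b : ℝ) * p b := by
    rw [← Finset.sum_filter]; congr 1
    ext b; simp only [Finset.mem_filter, Finset.mem_range]; omega
  have e2 : ∑ b ∈ Finset.range (m + 1), (if j < b ∧ b ≤ j + k₀ then (M - b) * p b else 0) =
      ∑ b ∈ Finset.Ioc j (j + k₀), (M - b) * p b := by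
    rw [← Finset.sum_filter]; congr 1
    ext b; simp only [Finset.mem_filter, Finset.mem_range, Finset.mem_Ioc]; omega
  have e3 : ∑ b ∈ Finset.range (m + 1), (if k₀ < b ∧ b ≤ j - a₂ then (M * π - (b + a₂ : ℕ)) * p (b + a₂) else 0) =
      ∑ b ∈ Finset.Ioc k₀ (j - a₂), (M * π - (b + a₂ : ℕ)) * p (b + a₂) := by
    rw [← Finset.sum_filter]; congr 1
    ext b; simp only [Finset.mem_filter, Finset.mem_range, Finset.mem_Ioc]; omega
  have e4 : ∑ b ∈ Finset.range (m + 1), (if j - a₁ < b ∧ b ≤ j then (M * π - b) * p b else 0) =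
      ∑ b ∈ Finset.Ioc (j - a₁) j, (M * π - b) * p b := by
    rw [← Finset.sum_filter]; congr 1
    ext b; simp only [Finset.mem_filter, Finset.mem_range, Finset.mem_Ioc]; omega
  -- the shifted sum equals the π-zone sum
  have e34 : ∑ b ∈ Finset.Ioc k₀ (j - a₂), (M * π - (b + a₂ : ℕ)) * p (b + a₂) =
      ∑ b ∈ Finset.Ioc (j - a₁) j, (M * π - b) * p b := by
    have hinj : Set.InjOn (fun b => b + a₂) ↑(Finset.Ioc k₀ (j - a₂)) := by
      intro b _ b' _ h; simp only at h; omega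
    have himg : Finset.image (fun b => b + a₂) (Finset.Ioc k₀ (j - a₂)) = Finset.Ioc (j - a₁) j := by
      ext b
      simp only [Finset.mem_image, Finset.mem_Ioc]
      constructor
      · rintro ⟨b', hb', rfl⟩; omega
      · intro hb; exact ⟨b - a₂, by omega, by omega⟩
    rw [← himg, Finset.sum_image hinj]
  -- the reflection pairing pays the zero zone
  have hpair := reflect_pairing p j k₀ M hk₀j (by
      have : ((2 * j - a₁ - a₂ : ℕ) : ℝ) + 1 ≤ m := by exact_mod_cast hm
      have e : ((2 * j - a₁ - a₂ : ℕ) : ℝ) = (j : ℝ) + k₀ := by rw [← hjk]; push_cast; ring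
      linarith) hp0 (fun b b' hb hbb' hb' => hmono b b' hb hbb' (by omega))
  rw [e1, e2, e3, e4, e34] at hS
  linarith

/-! ### 2. The block sum of two blocks -/

variable {n : ℕ}

/-- The block sum of `K = {x, y}` (`x ≠ y`) is `size x·1[x ∈ ω] + size y·1[y ∈ ω]`. [folklore] -/
theorem pair_blockSum_eq (x y : Fin n) (hxy : x ≠ y) (size : Fin n → ℕ) (ω : Set (Fin n)) :
    ∑ z ∈ ({x, y} : Finset (Fin n)).filter (fun z => z ∈ ω), size z =
      (if x ∈ ω then size x else 0) + (if y ∈ ω then size y else 0) := by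
  rw [Finset.sum_filter, Finset.sum_pair hxy]

/-- **Levels of two blocks.**  For `x ≠ y` with `size x ≤ size y` and `W = size x·1[x ∈ ω] + size y·1[y ∈ ω]`:
`P(i ≤ W) = 1` (`i = 0`), `1 − (1 − q x)(1 − q y)` (`1 ≤ i ≤ size x`), `q y` (`size x < i ≤ size y`), `q x·q y` (`size y < i ≤ size x + size y`),
`0` (`i > size x + size y`). [folklore] -/
theorem pair_blockSum_real (q : Fin n → unitInterval) (x y : Fin n) (hxy : x ≠ y) (size : Fin n → ℕ)
    (hs : size x ≤ size y) (i : ℕ) :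
    (prodBernoulli q).real {ω : Set (Fin n) | i ≤ ∑ z ∈ ({x, y} : Finset (Fin n)).filter (fun z => z ∈ ω), size z} =
      if i = 0 then 1 else if i ≤ size x then 1 - (1 - (q x : ℝ)) * (1 - (q y : ℝ))
        else if i ≤ size y then (q y : ℝ) else if i ≤ size x + size y then (q x : ℝ) * (q y : ℝ) else 0 := by
  have hev : {ω : Set (Fin n) | i ≤ ∑ z ∈ ({x, y} : Finset (Fin n)).filter (fun z => z ∈ ω), size z} =
      {ω : Set (Fin n) | i ≤ (if x ∈ ω then size x else 0) + (if y ∈ ω then size y else 0)} := by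
    ext ω; rw [Set.mem_setOf_eq, Set.mem_setOf_eq, pair_blockSum_eq x y hxy]
  rw [hev]
  split_ifs with h0 h1 h2 h3
  · have : {ω : Set (Fin n) | i ≤ (if x ∈ ω then size x else 0) + (if y ∈ ω then size y else 0)} = Set.univ := by
      ext ω; simp only [Set.mem_setOf_eq, Set.mem_univ, iff_true]; rw [h0]; exact Nat.zero_le _
    rw [this, probReal_univ]
  · -- `W ≥ i ⟺ x ∈ ω ∨ y ∈ ω`; complement of 'both absent'
    have : {ω : Set (Fin n) | i ≤ (if x ∈ ω then size x else 0) + (if y ∈ ω then size y else 0)} =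
        {ω : Set (Fin n) | ∀ z ∈ ({x, y} : Finset (Fin n)), z ∉ ω}ᶜ := by
      ext ω
      simp only [Set.mem_setOf_eq, Set.mem_compl_iff, Finset.mem_insert, Finset.mem_singleton, forall_eq_or_imp, forall_eq,
        not_and_or, not_not]
      constructor
      · intro h
        by_contra hc
        push Not at hc
        rw [if_neg hc.1, if_neg hc.2] at h; omega
      · intro h
        rcases h with hx | hy
        · rw [if_pos hx]; have := Nat.zero_le (if y ∈ ω then size y else 0); omega
        · rw [if_pos hy]; have := Nat.zero_le (if x ∈ ω then size x else 0); omega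
    rw [this, measureReal_compl (MeasurableSet.of_discrete) , probReal_univ, prodBernoulli_real_forall_notMem,
      Finset.prod_pair hxy]
  · have : {ω : Set (Fin n) | i ≤ (if x ∈ ω then size x else 0) + (if y ∈ ω then size y else 0)} = {ω | y ∈ ω} := by
      ext ω
      simp only [Set.mem_setOf_eq]
      constructor
      · intro h; by_contra hy; rw [if_neg hy] at h; split_ifs at h <;> omega
      · intro hy; rw [if_pos hy]; have := Nat.zero_le (if x ∈ ω then size x else 0); omega
    rw [this, prodBernoulli_real_setOf_mem]
  · have : {ω : Set (Fin n) | i ≤ (if x ∈ ω then size x else 0) + (if y ∈ ω then size y else 0)} =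
        {ω | ((({x, y} : Finset (Fin n)) : Set (Fin n))) ⊆ ω} := by
      ext ω
      simp only [Set.mem_setOf_eq, Finset.coe_insert, Finset.coe_singleton, Set.insert_subset_iff, Set.singleton_subset_iff]
      constructor
      · intro h
        constructor
        · by_contra hx; rw [if_neg hx] at h; split_ifs at h <;> omega
        · by_contra hy; rw [if_neg hy] at h; split_ifs at h <;> omega
      · rintro ⟨hx, hy⟩; rw [if_pos hx, if_pos hy]; exact h3
    rw [this, prodBernoulli_real_subset, Finset.prod_pair hxy]
  · have : {ω : Set (Fin n) | i ≤ (if x ∈ ω then size x else 0) + (if y ∈ ω then size y else 0)} = ∅ := by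
      ext ω
      simp only [Set.mem_setOf_eq, Set.mem_empty_iff_false, iff_false, not_le]
      split_ifs <;> omega
    rw [this, measureReal_empty]

/-! ### 3. The profile conjecture for `K = {x, y}`, jointly light, monotone hub laws -/

/-- **Profile conjecture, TWO jointly-light root blocks (any two gates), monotone hub law.**  In the binder shape of `Quant.HubBlocksProfileIneq`
with `K = {x, y}`, `x ≠ y`, `size x ≤ size y`, `size x + size y ≤ j`, and 'ratio-regular' weakened to 'nondecreasing below the mean': if
`2j < size x·q x + size y·q y + G·μ`, `τ ≤ μ/m`, `G·τ ≤ q x`, `G·τ ≤ q y` then `τ ≤ Σ_b p b·(P(W ≥ j+1−b) + ((1−G)/G)·P(W ≥ j+1))`.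
Via `Quant.mono_profile_twoLightBlocks` with `M = μ/τ`. [this work] -/
theorem hubBlocksProfileIneq_mono_pair (q : Fin n → unitInterval) (x y : Fin n) (hxy : x ≠ y) (size : Fin n → ℕ)
    (hs : size x ≤ size y) (m : ℕ) (p : ℕ → ℝ) (μ G τ : ℝ) (j : ℕ) (hlight : size x + size y ≤ j)
    (hp0 : ∀ b, 0 ≤ p b) (hsum : ∑ b ∈ Finset.range (m + 1), p b = 1)
    (hmean : ∑ b ∈ Finset.range (m + 1), (b : ℝ) * p b = μ) (hμ : 0 < μ)
    (hmono : ∀ b : ℕ, 1 ≤ b → (b : ℝ) ≤ μ → p (b - 1) ≤ p b)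
    (_hG0 : 0 < G) (hG1 : G ≤ 1)
    (hEN : (2 * j : ℝ) < (∑ z ∈ ({x, y} : Finset (Fin n)), (size z : ℝ) * (q z : ℝ)) + G * μ)
    (hτ : τ ≤ μ / m) (hτq : ∀ z ∈ ({x, y} : Finset (Fin n)), G * τ ≤ (q z : ℝ)) :
    τ ≤ ∑ b ∈ Finset.range (m + 1), p b *
      ((prodBernoulli q).real {ω : Set (Fin n) | j + 1 - b ≤ ∑ z ∈ ({x, y} : Finset (Fin n)).filter (fun z => z ∈ ω), size z} +
        (1 - G) / G *
          (prodBernoulli q).real {ω : Set (Fin n) | j + 1 ≤ ∑ z ∈ ({x, y} : Finset (Fin n)).filter (fun z => z ∈ ω), size z}) := by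
  simp only [pair_blockSum_real q x y hxy size hs, Finset.sum_pair hxy] at hEN ⊢
  have hqx := hτq x (by simp)
  have hqy := hτq y (by simp)
  set g₁ : ℝ := (q x : ℝ) with hg₁
  set g₂ : ℝ := (q y : ℝ) with hg₂
  set a₁ : ℕ := size x with ha₁
  set a₂ : ℕ := size y with ha₂
  have hg₁0 : 0 ≤ g₁ := (q x).2.1
  have hg₁1 : g₁ ≤ 1 := (q x).2.2
  have hg₂0 : 0 ≤ g₂ := (q y).2.1
  have hg₂1 : g₂ ≤ 1 := (q y).2.2
  have hμm : μ ≤ m := mean_le_top p m μ hp0 hsum hmean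
  have hm0 : 0 < m := by
    by_contra h; push Not at h; interval_cases m; simp at hμm; linarith
  have hm0' : (0 : ℝ) < m := by exact_mod_cast hm0
  -- the `κ`-term vanishes and the top case `j+1 = 0` is absurd
  have hj0 : ¬ (j + 1 = 0) := by omega
  have ht1 : ¬ (j + 1 ≤ a₁) := by omega
  have ht2 : ¬ (j + 1 ≤ a₂) := by omega
  have ht3 : ¬ (j + 1 ≤ a₁ + a₂) := by omega
  simp only [hj0, ht1, ht2, ht3, if_false, mul_zero, add_zero]
  -- nonnegativity of the test function (for `τ ≤ 0`)
  have hF0 : ∀ i : ℕ, 0 ≤ (if i = 0 then (1 : ℝ) else if i ≤ a₁ then 1 - (1 - g₁) * (1 - g₂)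
      else if i ≤ a₂ then g₂ else if i ≤ a₁ + a₂ then g₁ * g₂ else 0) := by
    intro i
    split_ifs
    exacts [zero_le_one, by nlinarith, hg₂0, mul_nonneg hg₁0 hg₂0, le_rfl]
  rcases le_or_gt τ 0 with hτ0 | hτ0
  · exact hτ0.trans (Finset.sum_nonneg fun b _ => mul_nonneg (hp0 b) (hF0 _))
  set M : ℝ := μ / τ with hMdef
  have hMm : (m : ℝ) ≤ M := by
    rw [hMdef, le_div_iff₀ hτ0]
    calc (m : ℝ) * τ ≤ m * (μ / m) := mul_le_mul_of_nonneg_left hτ (Nat.cast_nonneg m)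
      _ = μ := by field_simp
  -- `M gᵢ ≥ G μ > 2j − e`, `e ≤ a₁ + a₂ ≤ j`
  have hMg : ∀ g : ℝ, G * τ ≤ g → G * μ ≤ M * g := fun g hg => by
    have : G * τ * μ ≤ g * μ := mul_le_mul_of_nonneg_right hg hμ.le
    rw [hMdef, show μ / τ * g = g * μ / τ by ring, le_div_iff₀ hτ0]; linarith
  have hMg₁ := hMg g₁ hqx
  have hMg₂ := hMg g₂ hqy
  have ha₁' : (a₁ : ℝ) * g₁ ≤ a₁ := by nlinarith [(Nat.cast_nonneg a₁ : (0 : ℝ) ≤ a₁)]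
  have ha₂' : (a₂ : ℝ) * g₂ ≤ a₂ := by nlinarith [(Nat.cast_nonneg a₂ : (0 : ℝ) ≤ a₂)]
  have hlight' : (a₁ : ℝ) + a₂ ≤ j := by exact_mod_cast hlight
  have hs' : (a₁ : ℝ) ≤ a₂ := by exact_mod_cast hs
  have hGμ : G * μ ≤ μ := by nlinarith
  have hC1 : (j : ℝ) - a₁ ≤ M * g₂ := by linarith
  have hC2 : (2 * j : ℝ) - a₂ ≤ M * (g₁ + g₂) := by nlinarith
  have hC3 : (j : ℝ) ≤ M * (g₁ + g₂ - g₁ * g₂) := by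
    have hπ : g₂ ≤ g₁ + g₂ - g₁ * g₂ := by nlinarith
    have hM0 : 0 ≤ M := by rw [hMdef]; exact div_nonneg hμ.le hτ0.le
    have := mul_le_mul_of_nonneg_left hπ hM0
    linarith
  have h2j : (2 * j : ℝ) - a₁ - a₂ < μ := by linarith
  have hmono' : ∀ b b' : ℕ, 1 ≤ b → b ≤ b' → b' ≤ 2 * j - a₁ - a₂ → p b ≤ p b' := by
    intro b b' hb hbb' hb'
    refine mono_chain p μ hmono hbb' ?_
    have h1 : b' + a₁ + a₂ ≤ 2 * j := by omega
    have h2 : (b' : ℝ) + a₁ + a₂ ≤ 2 * j := by exact_mod_cast h1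
    linarith
  have hm' : 2 * j - a₁ - a₂ + 1 ≤ m := by
    have h1 : (2 * j : ℝ) - a₁ - a₂ < m := h2j.trans_le hμm
    have h2 : (2 * j : ℝ) < m + a₁ + a₂ := by linarith
    have h3 : 2 * j < m + a₁ + a₂ := by exact_mod_cast h2
    omega
  have key := mono_profile_twoLightBlocks p m j a₁ a₂ M g₁ g₂ hs hlight hp0 hmono' hm' hMm hC1 hC2 hC3
  rw [hmean] at key
  -- identify the test function
  have e : ∑ b ∈ Finset.range (m + 1), p b *
      ((if j < b then (1 : ℝ) else 0) + (g₁ + g₂ - g₁ * g₂) * (if j - a₁ < b ∧ b ≤ j then (1 : ℝ) else 0) +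
        g₂ * (if j - a₂ < b ∧ b ≤ j - a₁ then (1 : ℝ) else 0) + g₁ * g₂ * (if j - a₁ - a₂ < b ∧ b ≤ j - a₂ then (1 : ℝ) else 0)) =
      ∑ b ∈ Finset.range (m + 1), p b * (if j + 1 - b = 0 then (1 : ℝ) else if j + 1 - b ≤ a₁ then 1 - (1 - g₁) * (1 - g₂)
        else if j + 1 - b ≤ a₂ then g₂ else if j + 1 - b ≤ a₁ + a₂ then g₁ * g₂ else 0) := by
    refine Finset.sum_congr rfl fun b _ => ?_
    congr 1
    by_cases c1 : j < b
    · have d1 : j + 1 - b = 0 := by omega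
      have c2 : ¬ (j - a₁ < b ∧ b ≤ j) := by omega
      have c3 : ¬ (j - a₂ < b ∧ b ≤ j - a₁) := by omega
      have c4 : ¬ (j - a₁ - a₂ < b ∧ b ≤ j - a₂) := by omega
      rw [if_pos c1, if_neg c2, if_neg c3, if_neg c4, if_pos d1]; ring
    have d1 : ¬ (j + 1 - b = 0) := by omega
    by_cases c2 : j - a₁ < b ∧ b ≤ j
    · have d2 : j + 1 - b ≤ a₁ := by omega
      have c3 : ¬ (j - a₂ < b ∧ b ≤ j - a₁) := by omega
      have c4 : ¬ (j - a₁ - a₂ < b ∧ b ≤ j - a₂) := by omega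
      rw [if_neg c1, if_pos c2, if_neg c3, if_neg c4, if_neg d1, if_pos d2]; ring
    have d2 : ¬ (j + 1 - b ≤ a₁) := by omega
    by_cases c3 : j - a₂ < b ∧ b ≤ j - a₁
    · have d3 : j + 1 - b ≤ a₂ := by omega
      have c4 : ¬ (j - a₁ - a₂ < b ∧ b ≤ j - a₂) := by omega
      rw [if_neg c1, if_neg c2, if_pos c3, if_neg c4, if_neg d1, if_neg d2, if_pos d3]; ring
    have d3 : ¬ (j + 1 - b ≤ a₂) := by omega
    by_cases c4 : j - a₁ - a₂ < b ∧ b ≤ j - a₂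
    · have d4 : j + 1 - b ≤ a₁ + a₂ := by omega
      rw [if_neg c1, if_neg c2, if_neg c3, if_pos c4, if_neg d1, if_neg d2, if_neg d3, if_pos d4]; ring
    · have d4 : ¬ (j + 1 - b ≤ a₁ + a₂) := by omega
      rw [if_neg c1, if_neg c2, if_neg c3, if_neg c4, if_neg d1, if_neg d2, if_neg d3, if_neg d4]; ring
  rw [e] at key
  set S := ∑ b ∈ Finset.range (m + 1), p b * (if j + 1 - b = 0 then (1 : ℝ) else if j + 1 - b ≤ a₁ then 1 - (1 - g₁) * (1 - g₂)
        else if j + 1 - b ≤ a₂ then g₂ else if j + 1 - b ≤ a₁ + a₂ then g₁ * g₂ else 0) with hSdef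
  rw [hMdef] at key
  have hτne : τ ≠ 0 := hτ0.ne'
  have : τ * μ ≤ μ * S := by
    have := mul_le_mul_of_nonneg_left key hτ0.le
    calc τ * μ ≤ τ * (μ / τ * S) := this
      _ = μ * S := by field_simp
  nlinarith

end Quant

end Summit.CriticalPhenomena.PercolationContinuityZ3.Theorems
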